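import Summits.QuantumFields.YangMills.Theses.DyadicChessboard
import Summits.QuantumFields.YangMills.Theorems.InfiniteVolumePerOrderStateIVData
import Summits.QuantumFields.YangMills.Theorems.InfiniteVolumeMomentBoundsOnSides
import Summits.QuantumFields.YangMills.Theorems.TypicalExteriorCeilingsFactorialCalibration
import Summits.QuantumFields.YangMills.Theorems.OnsetCalibrationOnsetVanishes

/-!
# Route `DyadicChessboard` (ym-idea-11 g9 LINE 1 «chessboard on dyadic tori») — the support item `DyadicCalibration`
# (stmt-QuantumFields-23371), PROVED

`DyadicCalibration`: the DYADIC factorial sub-onset ceilings (centred mixed plane moments `≤ (C n^κ/R⁴)ⁿ` on the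
dyadic tori `(ℤ/2^m)⁴`, `m ≥ m₀(β)`, `8R+16 ≤ 2^m`, at every sub-onset resolution — the output of `ChessboardTransfer`)
`→ OddDyadicCoincidence (K2) → FloorsC (= OnsetCalibration.OnsetFloors) → InfiniteVolumeContinuum.HypercubicOSDataFromInfiniteVolume`
(rung R2a-IV).

Proof.  Verbatim the landed calibration `ThermodynamicCeilings.largeVolumeCalibration_proof` (width seat w2 g21: unit
`a(β)` = an onset resolution above half the top of the onset set; `a → 0` by the LANDED `OnsetCalibration.onsetVanishes_proof`;
floors at `a` by membership; the ceilings are read at `a(β)` because every `s' ≥ 2a(β)` lies above the onset set) run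
with the STATE-LEVEL per-order infinite-volume engine `InfiniteVolume.PerOrderState.ivData_perOrderState` (files
`InfiniteVolumePerOrderState{TorusScheme,Compactness,CentreBase,IVData}`, this seat): the landed engines consume odd-torus
ceilings only through the inheritance to the odd-torus limit states and through the torus side of the junction; here
(i) the states are K2's odd∩dyadic limit points `μ_β` (chosen by `choose`, arbitrary below the thresholds), (ii) their
collar bound is inherited from the DYADIC ceilings along K2's dyadic sequence `2^{S'_k}` (`abs_integral_centred_prod_le_of_eventually`;
the side conditions `m₀ ≤ S'_k`, `8R+16 ≤ 2^{S'_k}` and the cyclic separation hold eventually; the side cast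
`2^{S'_k} − 1 + 1 = 2^{S'_k}` is `wilsonExpectation_centred_cast`), and (iii) the junction is the ceiling-free
operator-norm junction.  E0′ output `‖S₁ n F‖ ≤ 5(A + B·C n^κ)ⁿ‖F‖_{10n}` of linear growth (exponent `1+κ`,
`TypicalExteriorCeilings.pow_affine_rpow_le_factorial`); reflection positivity, hermiticity and hyperoctahedral
invariance by the landed theorems BY NAME (they only read `μ_k ∈ oddTorusLimitPoints`).
Width seat `ym-line-sfw-p2-w2` g23 (cell ym-idea-1, free hands).

HONEST LABEL: this closes only a support item; the leaf then rests on the OPEN cruxes K1 `DyadicArrayCeiling` (through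
`ChessboardTransfer` ✓), K2 `OddDyadicCoincidence` and `FloorsC` (= the NT residual `OnsetFloors`), all of open-problem
class.  No summit, no mass gap and no Clay statement is proved here; rung R2a RECORD label only.

References: K. Osterwalder, E. Seiler, Ann. Phys. 110 (1978) 440–471 [OsterwalderSeiler1978]; S. Chatterjee,
arXiv:1803.01950 §2; K. Osterwalder, R. Schrader, CMP 42 (1975) 281–305 (§2, E0′); J. Glimm, A. Jaffe, Quantum Physics
(1987) §6.1.
-/

set_option autoImplicit false

noncomputable section

open scoped BigOperators SchwartzMap
open MeasureTheory Filter Topology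
open Literature.MathematicalPhysics.QuantumFieldTheory Literature.MathematicalPhysics.QuantumLattice
open Literature.MathematicalPhysics.AQFT
open Literature.Probability.LatticeModels (Site)
open Summit.QuantumFields.YangMills.Cruxes.OSLegsFromFemtoAndGap.DlrCollarTransfer
open Summit.QuantumFields.YangMills.Theorems.InfiniteVolume
  (stateMomentStr abs_integral_centred_prod_le_of_eventually eventually_le_of_strictMono exists_abs_sub_le
    valMinAbs_intCast_of_two_mul_abs_lt measurable_plane)
open Summit.QuantumFields.YangMills.Theorems.InfVolRP

namespace Summit.QuantumFields.YangMills.Theorems.DyadicChessboard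

/-- Side cast for per-torus-centred expectations: the centred product expectation on the torus of raw side `M`
depends on `M` only through its value (used with `2^m − 1 + 1 = 2^m`). [folklore] -/
theorem wilsonExpectation_centred_cast {G : Type} [Group G] [TopologicalSpace G] [IsTopologicalGroup G]
    [CompactSpace G] [MeasurableSpace G] [BorelSpace G] {N : ℕ}
    (ρ : G →* Matrix (Fin N) (Fin N) ℂ) (β : ℝ) {M M' : ℕ} [NeZero M] [NeZero M'] (h : M = M') {n : ℕ}
    (f : Fin n → LGConfig 4 G → ℝ) :
    wilsonExpectation (L := M) ρ β (toTorusObservable M fun U =>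
        ∏ i, (f i U - wilsonExpectation (L := M) ρ β (toTorusObservable M (f i)))) =
      wilsonExpectation (L := M') ρ β (toTorusObservable M' fun U =>
        ∏ i, (f i U - wilsonExpectation (L := M') ρ β (toTorusObservable M' (f i)))) := by
  subst h
  rfl

/-- **Support `DyadicCalibration` of route `DyadicChessboard`** (stmt-QuantumFields-23371): dyadic factorial sub-onset
ceilings → `OddDyadicCoincidence` → `OnsetFloors` → `HypercubicOSDataFromInfiniteVolume`, by the calibration of
`largeVolumeCalibration_proof` run with the state-level per-order infinite-volume engine on K2's odd∩dyadic states,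
whose collar bound is inherited from the dyadic ceilings.  Support plumbing only. -/
theorem dyadicCalibration_proof :
    Summit.QuantumFields.YangMills.Theses.DyadicChessboard.DyadicCalibration := by
  unfold Summit.QuantumFields.YangMills.Theses.DyadicChessboard.DyadicCalibration
    Summit.QuantumFields.YangMills.Theses.DyadicChessboard.OddDyadicCoincidence
    Summit.QuantumFields.YangMills.Theses.DyadicChessboard.FloorsC
  intro hK2 hO hK1 G _ _ _ _ hG hcl
  have hU := Summit.QuantumFields.YangMills.Theorems.OnsetCalibration.onsetVanishes_proof
  letI : MeasurableSpace G := borel G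
  haveI : BorelSpace G := ⟨rfl⟩
  -- K1: the floor datum
  obtain ⟨r, v, f, g, h, ε₁, Λ₅, β₅, hv, hfg, hgh, hfh, hε₁, hfloor⟩ := hK1 G hG hcl
  -- the dyadic factorial ceilings at that datum: the admissible floor levels
  obtain ⟨ε₀, hε₀, hK2'⟩ := hK2 G hG hcl r v f g h Λ₅
  have hεpos : 0 < min ε₁ ε₀ := lt_min hε₁ hε₀
  -- the level `ε := min ε₁ ε₀` is live from `β₅` on
  have hlive : ∀ β : ℝ, β₅ ≤ β → ∃ s : ℝ, 0 < s ∧ s ≤ 1 ∧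
      (∀ L : ℕ, Λ₅ ≤ s * L → min ε₁ ε₀ ≤ Q2 G r β L s (thetaTest 4 v) v) ∧
      (∀ L : ℕ, Λ₅ ≤ s * L → min ε₁ ε₀ ≤ |Q3 G r β L s f g h|) := by
    intro β hβ
    obtain ⟨s, hs0, hs1, h2, h3⟩ := hfloor β hβ
    exact ⟨s, hs0, hs1, fun L hL => (min_le_left _ _).trans (h2 L hL),
      fun L hL => (min_le_left _ _).trans (h3 L hL)⟩
  obtain ⟨C, κ, ℓ₄, β₄, hℓ₄, hC, hκ, hceil⟩ := hK2' (min ε₁ ε₀) hεpos (min_le_right _ _) ⟨β₅, hlive⟩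
  -- K2: the odd∩dyadic infinite-volume limit states
  obtain ⟨β₆, hβ₆⟩ := hO G hG hcl r
  -- the onset set `S β` (opaque, with its membership lemma)
  obtain ⟨S, hS⟩ : ∃ S : ℝ → Set ℝ, ∀ β s, s ∈ S β ↔ (0 < s ∧ s ≤ 1 ∧
      (∀ L : ℕ, Λ₅ ≤ s * L → min ε₁ ε₀ ≤ Q2 G r β L s (thetaTest 4 v) v) ∧
      (∀ L : ℕ, Λ₅ ≤ s * L → min ε₁ ε₀ ≤ |Q3 G r β L s f g h|)) :=
    ⟨fun β => {s | 0 < s ∧ s ≤ 1 ∧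
      (∀ L : ℕ, Λ₅ ≤ s * L → min ε₁ ε₀ ≤ Q2 G r β L s (thetaTest 4 v) v) ∧
      (∀ L : ℕ, Λ₅ ≤ s * L → min ε₁ ε₀ ≤ |Q3 G r β L s f g h|)}, fun _ _ => Iff.rfl⟩
  have hSbdd : ∀ β, BddAbove (S β) := fun β => ⟨1, fun s hs => ((hS β s).1 hs).2.1⟩
  have hSne : ∀ β : ℝ, β₅ ≤ β → (S β).Nonempty := fun β hβ => by
    obtain ⟨s, hs0, hs1, h2, h3⟩ := hlive β hβ
    exact ⟨s, (hS β s).2 ⟨hs0, hs1, h2, h3⟩⟩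
  -- the calibrated unit: an onset resolution above half the top of the onset set
  have hex : ∀ β : ℝ, ∃ s : ℝ, 0 < s ∧ ((S β).Nonempty → s ∈ S β ∧ sSup (S β) / 2 < s) := by
    intro β
    by_cases hne : (S β).Nonempty
    · have hpos : 0 < sSup (S β) := by
        obtain ⟨s, hs⟩ := hne
        exact lt_of_lt_of_le ((hS β s).1 hs).1 (le_csSup (hSbdd β) hs)
      obtain ⟨s, hs, hlt⟩ := exists_lt_of_lt_csSup hne (show sSup (S β) / 2 < sSup (S β) by linarith)
      exact ⟨s, ((hS β s).1 hs).1, fun _ => ⟨hs, hlt⟩⟩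
    · exact ⟨1, one_pos, fun h' => (hne h').elim⟩
  choose a ha_pos ha_mem using hex
  -- U: the unit tends to zero
  have ha0 : Tendsto a atTop (nhds 0) := by
    rw [Metric.tendsto_atTop]
    intro s₀ hs₀
    obtain ⟨β₁, hβ₁⟩ := hU G hG hcl r v f g h (min ε₁ ε₀) Λ₅ s₀ hεpos hs₀
    refine ⟨max β₁ β₅, fun β hβ => ?_⟩
    have hmem := (hS β (a β)).1 ((ha_mem β (hSne β (le_of_max_le_right hβ))).1)
    rw [Real.dist_0_eq_abs, abs_of_pos (ha_pos β)]
    exact lt_of_not_ge fun hcon => hβ₁ β (le_of_max_le_left hβ) (a β) hcon hmem.2.1 ⟨hmem.2.2.1, hmem.2.2.2⟩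
  -- the floors at the calibrated unit, by membership
  have hlb : LowerBounds G r a := by
    refine ⟨⟨v, min ε₁ ε₀, β₅, Λ₅, hv, hεpos, fun β hβ L hL => ?_⟩,
      ⟨f, g, h, min ε₁ ε₀, β₅, Λ₅, hfg, hgh, hfh, hεpos, fun β hβ L hL => ?_⟩⟩
    · have hmem := (hS β (a β)).1 ((ha_mem β (hSne β hβ)).1)
      exact hmem.2.2.1 L hL
    · have hmem := (hS β (a β)).1 ((ha_mem β (hSne β hβ)).1)
      exact hmem.2.2.2 L hL
  -- K2's states as a function of `β` (arbitrary below the thresholds)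
  have hexμ : ∀ β : ℝ, ∃ μ : Measure (LGConfig 4 G), max (max β₄ β₅) β₆ ≤ β →
      μ ∈ oddTorusLimitPoints r β ∧ ∃ S' : ℕ → ℕ, StrictMono S' ∧
        IsInfiniteVolumeLimitAlong (d := 4) r.ρ β (fun k => 2 ^ S' k - 1) μ := by
    intro β
    by_cases hβ : max (max β₄ β₅) β₆ ≤ β
    · obtain ⟨μ, hμ, S', hS', hlim⟩ := hβ₆ β (le_of_max_le_right hβ)
      exact ⟨μ, fun _ => ⟨hμ, S', hS', hlim⟩⟩
    · exact ⟨0, fun h' => absurd h' hβ⟩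
  choose μβ hμβ using hexμ
  have hμmem : ∀ β : ℝ, max (max β₄ β₅) β₆ ≤ β → μβ β ∈ oddTorusLimitPoints r β := fun β hβ => (hμβ β hβ).1
  -- the DYADIC factorial ceilings at the calibrated unit pass to K2's states along the dyadic sequence:
  -- the per-order STATE collar bound (every `s' ≥ 2 a β` lies above the onset set)
  obtain ⟨Cp, hCp⟩ := exists_abs_plane_le (G := G) r
  have hW : ∀ β : ℝ, max (max β₄ β₅) β₆ ≤ β →
      ∀ (n : ℕ) (q : Fin n → Fin 4 × Fin 4) (x : Fin n → (Fin 4 → ℤ)) (R : ℕ), (∀ i, (q i).1 < (q i).2) →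
        1 ≤ R → (R : ℝ) * a β ≤ ℓ₄ →
        (∀ i j : Fin n, i ≠ j → ∃ k : Fin 4, (2 * (R : ℤ) + 4) ≤ |x i k - x j k|) →
        |∫ U, ∏ i, (plane G r (q i) (x i) U - ∫ V, plane G r (q i) (x i) V ∂(μβ β)) ∂(μβ β)| ≤
          (C * (n : ℝ) ^ κ / (R : ℝ) ^ 4) ^ n := by
    intro β hβ n q x R hq hR hRa hsep
    have hβ4 : β₄ ≤ β := le_trans (le_max_left _ _) (le_trans (le_max_left _ _) hβ)
    have hβ5 : β₅ ≤ β := le_trans (le_max_right _ _) (le_trans (le_max_left _ _) hβ)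
    obtain ⟨m₀, hm₀⟩ := hceil β hβ4
    obtain ⟨-, S', hS', hlim⟩ := hμβ β hβ
    have hne := hSne β hβ5
    have hmem := (hS β (a β)).1 ((ha_mem β hne).1)
    have hhalf := (ha_mem β hne).2
    have hsub : ∀ s' : ℝ, 2 * a β ≤ s' → s' ≤ 1 →
        ¬ ((∀ L : ℕ, Λ₅ ≤ s' * L → min ε₁ ε₀ ≤ Q2 G r β L s' (thetaTest 4 v) v) ∧
          (∀ L : ℕ, Λ₅ ≤ s' * L → min ε₁ ε₀ ≤ |Q3 G r β L s' f g h|)) := by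
      intro s' h2s hs1 hFl
      have hs'mem : s' ∈ S β := (hS β s').2 ⟨by linarith [ha_pos β], hs1, hFl.1, hFl.2⟩
      have := le_csSup (hSbdd β) hs'mem
      linarith
    have hcm := hm₀ (a β) hmem.1 hmem.2.1 hsub
    refine abs_integral_centred_prod_le_of_eventually r.ρ r.continuous hlim (fun i => plane G r (q i) (x i))
      (fun i => ⟨_, isCylinder_plane r (q i) (x i)⟩) (fun i => continuous_plane r (q i) (x i))
      (fun i => measurable_plane r (q i) (x i)) (fun i => ⟨Cp, hCp (q i) (x i)⟩) ?_
    -- eventually along the dyadic sides: `m₀ ≤ S' k`, `8R+16 ≤ 2^{S' k}`, cyclic separation (no wrap-around)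
    obtain ⟨Mb, hMb⟩ := exists_abs_sub_le x
    filter_upwards [eventually_le_of_strictMono hS' m₀, eventually_le_of_strictMono hS' (8 * R + 16),
      eventually_le_of_strictMono hS' (2 * Mb)] with k hkm hkR hkM
    have h2pow : S' k < 2 ^ S' k := Nat.lt_two_pow_self
    have hRk : 8 * R + 16 ≤ 2 ^ S' k := by omega
    haveI : NeZero (2 ^ S' k) := ⟨pow_ne_zero _ two_ne_zero⟩
    have hsepk : ∀ i j : Fin n, i ≠ j → ∃ k' : Fin 4,
        (2 * (R : ℤ) + 4) ≤ |((((x i k' - x j k' : ℤ) : ZMod (2 ^ S' k))).valMinAbs : ℤ)| := by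
      intro i j hij
      obtain ⟨m, hm⟩ := hsep i j hij
      refine ⟨m, ?_⟩
      have hlt : 2 * |x i m - x j m| < ((2 ^ S' k : ℕ) : ℤ) := by
        have h1 : ((2 * Mb : ℕ) : ℤ) ≤ S' k := by exact_mod_cast hkM
        have h2 : ((S' k : ℕ) : ℤ) < ((2 ^ S' k : ℕ) : ℤ) := by exact_mod_cast h2pow
        have := hMb i j m
        push_cast at h1 h2 ⊢
        linarith
      rwa [valMinAbs_intCast_of_two_mul_abs_lt hlt]
    have hk := hcm (S' k) n q x R hq hR hRa hRk hkm hsepk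
    rw [wilsonExpectation_centred_cast r.ρ β (Nat.sub_add_cancel Nat.one_le_two_pow)
      (fun i => plane G r (q i) (x i))]
    exact hk
  -- the STATE-LEVEL per-order infinite-volume engine on K2's states
  obtain ⟨βk, μ, S₁, T, hdata, hN, ⟨A, B, hA, hB, hbd⟩, hSym, hTr, hNT, hNG⟩ :=
    Summit.QuantumFields.YangMills.Theorems.InfiniteVolume.PerOrderState.ivData_perOrderState r a ha_pos ha0 hlb
      (fun n => C * (n : ℝ) ^ κ) μβ hℓ₄ (fun n => by positivity) hμmem hW
  obtain ⟨hβ, hμ, h0, h1, hS', hT⟩ := id hdata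
  -- a faithful continuous matrix representation of the compact group makes it Hausdorff and second countable
  haveI : T2Space G := (r.continuous.isClosedEmbedding r.injective).isEmbedding.t2Space
  haveI : SecondCountableTopology G :=
    (r.continuous.isClosedEmbedding r.injective).isEmbedding.secondCountableTopology
  -- E2: exact lattice reflection positivity inherited along the limit (landed, BY NAME)
  have hβev : ∀ᶠ k in atTop, 0 ≤ βk k := hβ.eventually_ge_atTop 0
  have hrp := rpPos_of_oddTorusLimitStates_centre r hβev μ hμ (fun k => ha_pos (βk k)) (ha0.comp hβ) T
    (fun n hn q hq F hF => by
      have hpt : ∀ (k : ℕ) (x : Fin n → Site 4),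
          (fun l => a (βk k) • (siteToE (x l) + centreOffset (q l))) =
            fun l => a (βk k) • siteToE (x l) +
              (a (βk k) / 2) • (EuclideanSpace.single (q l).1 (1 : ℝ) + EuclideanSpace.single (q l).2 (1 : ℝ)) :=
        fun k x => funext fun l => by
          unfold centreOffset
          rw [if_pos (hq l), smul_add, smul_smul, mul_one_div]
      simp_rw [hpt]
      exact hT n hn q hq F hF) S₁ hS' h0 h1
  have hE2 := hrp.2
  have hE0h := Summit.QuantumFields.YangMills.Theorems.OSLegsFromFemtoAndGap.isHermitian_of_isReflectionPositive
    S₁ hN hE2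
  -- E0′: the factorial currency is of linear growth, exponent `1 + κ`
  have hLG : S₁.toLabelled.HasLinearGrowth := by
    intro _
    refine ⟨10, 5 * Real.exp ((A + B * C) * Real.exp κ), 1 + κ, fun n k _ F _ => ?_⟩
    simp only [SchwingerFamily.toLabelled_apply]
    calc ‖S₁ n F‖ ≤ 5 * (A + B * (C * (n : ℝ) ^ κ)) ^ n * schwartzNorm (10 * n) F := hbd n F
      _ ≤ 5 * (Real.exp ((A + B * C) * Real.exp κ) * ((n.factorial : ℝ)) ^ (1 + κ)) * schwartzNorm (10 * n) F := by
          gcongr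
          · exact schwartzNorm_nonneg _ _
          · exact TypicalExteriorCeilings.pow_affine_rpow_le_factorial hA hB hC hκ n
      _ = 5 * Real.exp ((A + B * C) * Real.exp κ) * ((n.factorial : ℝ)) ^ (1 + κ) * schwartzNorm (n * 10) F := by
          rw [mul_comm n 10]; ring
  -- hyperoctahedral invariance on ⁰𝒮: exact on the lattice, passes to the limit (E1.stub_ivSigned, by name)
  have hW4 := Summit.QuantumFields.YangMills.Theorems.InfiniteVolume.E1.stub_ivSigned r a βk μ S₁ T ha_pos hμ h0 h1
    hS' hT
  exact ⟨r, a, βk, μ, S₁, T, ha_pos, ha0, hdata, hN, hE0h, hLG, fun R hR n F hF => hW4 R hR n F hF, hE2, hSym,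
    hTr, hNT, hNG⟩

end Summit.QuantumFields.YangMills.Theorems.DyadicChessboard

end
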